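import Mathlib
import HarnessLib
import Literature.Probability.MarkovChains.SpectralRepresentation

/-!
# The decay rate of the distance to stationarity: `lim_{t→∞} d(t)^{1/t} = λ⋆` (Levin–Peres–Wilmer Corollary 12.7)

HONEST FRAMING: exact (Metropolis-corrected) sampling algorithms for lattice gauge theory; figures
of merit are autocorrelation/cost numbers at stated couplings and volumes; no continuum-physics claim.

Conventions of `BottleneckRatio.lean` (`worstTvDist P π t = d(t) = max_x ‖Pᵗ(x,·) − π‖_TV`),
`RelaxationTime.lean` (`lambdaStar P = λ⋆ = max{|λ| : λ ≠ 1 an eigenvalue of P}`, `0` if there is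
none), `RelaxationTimeLowerBound.lean` (eq. (12.15) `|λ|ᵗ ≤ 2d(t)`) and `SpectralRepresentation.lean`
(eq. (12.13), `tvDist_kernelAt_le`: `‖Pᵗ(x,·) − π‖_TV ≤ λ⋆ᵗ/(2π_min)` for reversible irreducible `P`).
Source: D. A. Levin, Y. Peres (with E. L. Wilmer), *Markov Chains and Mixing Times*, 2nd ed., AMS
2017 [LevinPeres2017], §12.2.  Everything is PROVED (0 named facts).

* `lambdaStar_pow_le_two_mul_worstTvDist` — (12.15) at an eigenvalue attaining `λ⋆`:
  **`λ⋆ᵗ ≤ 2d(t)`** (`t ≥ 1`; every row-stochastic `P` with `πP = π`) [cite: LevinPeres2017, §12.2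
  eq. (12.15)];
* `worstTvDist_le_lambdaStar_pow_div` — (12.13) summed: **`d(t) ≤ λ⋆ᵗ/(2π_min)`** for a reversible
  irreducible `P` with positive stationary `π ≥ π_min > 0` [cite: LevinPeres2017, §12.2 eq. (12.13)
  (proof of Thm 12.4)];
* **COROLLARY 12.7** `LevinPeres2017_cor_12_7`: for a reversible, irreducible Markov chain (positive
  stationary probability vector `π`), **`lim_{t→∞} d(t)^{1/t} = λ⋆`** — `Tendsto (fun t ↦ d(t)^(1/t))
  atTop (𝓝 λ⋆)` with the real power `rpow` [cite: LevinPeres2017, §12.2 Cor 12.7].  Proof as printed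
  ("One direction is immediate from (12.15), and the other follows from (12.13)"): for `t ≥ 1`,
  `(1/2)^{1/t}·λ⋆ ≤ d(t)^{1/t} ≤ (1/(2π_min))^{1/t}·λ⋆`, and `c^{1/t} → 1`.  SCOPE: the book also
  assumes aperiodicity (so that `λ⋆ < 1`); the limit identity does not use it and it is not assumed.

Context (cell pub-lqcd, venture LatticeQCDFlow): `λ⋆` IS the asymptotic exponential decay rate of
the worst-case total-variation distance — the rigorous meaning of "the autocorrelation time is
`1/log(1/λ⋆) ≈ t_rel`" used when exponential autocorrelation times of samplers are compared.
-/

open Finset Filter Topology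

namespace Literature.Probability.MarkovChains

variable {X : Type*} [Fintype X] [DecidableEq X]

/-- **(12.15) at `λ⋆`: `λ⋆ᵗ ≤ 2·d(t)`** for `t ≥ 1`, for every row-stochastic `P` with stationary
probability vector `π` (at an eigenvalue `λ ≠ 1` with `|λ| = λ⋆`; if `P` has no eigenvalue `≠ 1`
then `λ⋆ = 0`). [cite: LevinPeres2017, §12.2 eq. (12.15)] -/
theorem lambdaStar_pow_le_two_mul_worstTvDist {P : X → X → ℝ} {π : X → ℝ} (hπ : IsStationary π P)
    {t : ℕ} (ht : t ≠ 0) : lambdaStar P ^ t ≤ 2 * worstTvDist P π t := by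
  by_cases h : (nontrivialEigenvalues P).Nonempty
  · obtain ⟨μ, hμ, hμeq⟩ := exists_norm_eq_lambdaStar h
    obtain ⟨f, hf⟩ := hμ.1.exists_hasEigenvector
    obtain ⟨hf0, hfx⟩ := (hasEigenvector_iff P f μ).mp hf
    rw [← hμeq]
    exact norm_eigenvalue_pow_le_two_mul_worstTvDist hπ hfx hf0 hμ.2 t
  · have h0 : lambdaStar P = 0 := by
      unfold lambdaStar
      rw [Set.not_nonempty_iff_eq_empty.mp h, Set.image_empty, Real.sSup_empty]
    rw [h0, zero_pow ht]
    exact mul_nonneg zero_le_two (worstTvDist_nonneg P π t)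

/-- **(12.13), summed over `y`: `d(t) ≤ λ⋆ᵗ/(2π_min)`** for a reversible irreducible `P` with
positive stationary probability vector `π` and any `0 < π_min ≤ min_x π(x)`.
[cite: LevinPeres2017, §12.2 eq. (12.13) (proof of Thm 12.4: "`≤ λ⋆ᵗ/π_min`")] -/
theorem worstTvDist_le_lambdaStar_pow_div {P : X → X → ℝ} {π : X → ℝ} (hπ : ∀ x, 0 < π x)
    (hπ1 : ∑ x, π x = 1) (hP : IsRowStochastic P) (hDB : DetailedBalance π P)
    (hirr : IsIrreducible P) {πmin : ℝ} (hmin0 : 0 < πmin) (hmin : ∀ x, πmin ≤ π x) (t : ℕ) :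
    worstTvDist P π t ≤ lambdaStar P ^ t / (2 * πmin) :=
  Real.iSup_le (fun x => tvDist_kernelAt_le hπ hπ1 hP hDB hirr hmin0 hmin t x)
    (div_nonneg (pow_nonneg (lambdaStar_nonneg P) t) (by linarith))

/-- `c^{1/t} → 1` as `t → ∞` (`c > 0`). [folklore] -/
private theorem tendsto_const_rpow_one_div {c : ℝ} (hc : 0 < c) :
    Tendsto (fun t : ℕ => c ^ (1 / (t : ℝ))) atTop (𝓝 1) := by
  have h1 : Tendsto (fun t : ℕ => Real.log c * (1 / (t : ℝ))) atTop (𝓝 (Real.log c * 0)) :=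
    tendsto_const_nhds.mul tendsto_one_div_atTop_nhds_zero_nat
  rw [mul_zero] at h1
  have h2 := (Real.continuous_exp.tendsto 0).comp h1
  rw [Real.exp_zero] at h2
  refine h2.congr fun t => ?_
  rw [Function.comp_apply, Real.rpow_def_of_pos hc]

/-- **Corollary 12.7.**  For a reversible, irreducible Markov chain with transition matrix `P` and
positive stationary probability vector `π` on a finite state space,
**`lim_{t→∞} d(t)^{1/t} = λ⋆`**.  ("One direction is immediate from (12.15), and the other follows
from (12.13).")  The book's aperiodicity hypothesis is not needed for the identity and not assumed.
[cite: LevinPeres2017, §12.2 Cor 12.7] -/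
theorem LevinPeres2017_cor_12_7 {P : X → X → ℝ} {π : X → ℝ} (hπ : ∀ x, 0 < π x)
    (hπ1 : ∑ x, π x = 1) (hP : IsRowStochastic P) (hDB : DetailedBalance π P)
    (hirr : IsIrreducible P) :
    Tendsto (fun t : ℕ => worstTvDist P π t ^ (1 / (t : ℝ))) atTop (𝓝 (lambdaStar P)) := by
  have hst : IsStationary π P := hDB.isStationary hP.2
  have hl0 : 0 ≤ lambdaStar P := lambdaStar_nonneg P
  -- `π_min = min_x π(x) > 0` (X is nonempty since `Σ π = 1`)
  have hne : Nonempty X := by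
    by_contra hX
    rw [not_nonempty_iff] at hX
    simp [univ_eq_empty] at hπ1
  obtain ⟨x₀, -, hx₀⟩ := exists_min_image univ π univ_nonempty
  set πmin : ℝ := π x₀ with hπmin
  have hmin0 : 0 < πmin := hπ x₀
  have hmin : ∀ x, πmin ≤ π x := fun x => hx₀ x (mem_univ x)
  set C : ℝ := 1 / (2 * πmin) with hC
  have hCpos : 0 < C := by positivity
  -- the two bounds, for `t ≥ 1`: `(1/2)^{1/t} λ⋆ ≤ d(t)^{1/t} ≤ C^{1/t} λ⋆`
  have hpow_root : ∀ {t : ℕ}, t ≠ 0 → (lambdaStar P ^ t) ^ (1 / (t : ℝ)) = lambdaStar P := by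
    intro t ht
    rw [one_div]
    exact Real.pow_rpow_inv_natCast hl0 ht
  have hlow : ∀ᶠ t : ℕ in atTop,
      (1 / 2 : ℝ) ^ (1 / (t : ℝ)) * lambdaStar P ≤ worstTvDist P π t ^ (1 / (t : ℝ)) := by
    refine eventually_atTop.2 ⟨1, fun t ht => ?_⟩
    have ht0 : t ≠ 0 := by omega
    have hexp : 0 ≤ 1 / (t : ℝ) := by positivity
    have h15 : (1 / 2 : ℝ) * lambdaStar P ^ t ≤ worstTvDist P π t := by
      have := lambdaStar_pow_le_two_mul_worstTvDist hst ht0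
      linarith
    calc (1 / 2 : ℝ) ^ (1 / (t : ℝ)) * lambdaStar P
        = (1 / 2 : ℝ) ^ (1 / (t : ℝ)) * (lambdaStar P ^ t) ^ (1 / (t : ℝ)) := by rw [hpow_root ht0]
      _ = ((1 / 2 : ℝ) * lambdaStar P ^ t) ^ (1 / (t : ℝ)) :=
          (Real.mul_rpow (by norm_num) (pow_nonneg hl0 t)).symm
      _ ≤ worstTvDist P π t ^ (1 / (t : ℝ)) :=
          Real.rpow_le_rpow (by positivity) h15 hexp
  have hupp : ∀ᶠ t : ℕ in atTop,
      worstTvDist P π t ^ (1 / (t : ℝ)) ≤ C ^ (1 / (t : ℝ)) * lambdaStar P := by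
    refine eventually_atTop.2 ⟨1, fun t ht => ?_⟩
    have ht0 : t ≠ 0 := by omega
    have hexp : 0 ≤ 1 / (t : ℝ) := by positivity
    have h13 : worstTvDist P π t ≤ C * lambdaStar P ^ t := by
      have := worstTvDist_le_lambdaStar_pow_div hπ hπ1 hP hDB hirr hmin0 hmin t
      rw [hC]
      calc worstTvDist P π t ≤ lambdaStar P ^ t / (2 * πmin) := this
        _ = 1 / (2 * πmin) * lambdaStar P ^ t := by ring
    calc worstTvDist P π t ^ (1 / (t : ℝ)) ≤ (C * lambdaStar P ^ t) ^ (1 / (t : ℝ)) :=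
          Real.rpow_le_rpow (worstTvDist_nonneg P π t) h13 hexp
      _ = C ^ (1 / (t : ℝ)) * (lambdaStar P ^ t) ^ (1 / (t : ℝ)) :=
          Real.mul_rpow hCpos.le (pow_nonneg hl0 t)
      _ = C ^ (1 / (t : ℝ)) * lambdaStar P := by rw [hpow_root ht0]
  -- both envelopes tend to `λ⋆`
  have hg : Tendsto (fun t : ℕ => (1 / 2 : ℝ) ^ (1 / (t : ℝ)) * lambdaStar P) atTop
      (𝓝 (lambdaStar P)) := by
    have := (tendsto_const_rpow_one_div (by norm_num : (0 : ℝ) < 1 / 2)).mul_const (lambdaStar P)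
    rwa [one_mul] at this
  have hh : Tendsto (fun t : ℕ => C ^ (1 / (t : ℝ)) * lambdaStar P) atTop (𝓝 (lambdaStar P)) := by
    have := (tendsto_const_rpow_one_div hCpos).mul_const (lambdaStar P)
    rwa [one_mul] at this
  exact tendsto_of_tendsto_of_tendsto_of_le_of_le' hg hh hlow hupp

end Literature.Probability.MarkovChains
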